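import Mathlib
import HarnessLib
import Summits.Ventures.LatticeQCDFlow.Scoring.GaussianStudentShiftMonotone

/-!
# THE DETECTABLE DRIFT OF THE FIXED-COUNT A-VS-B CRITERION: FOR `t ≠ 0`, `a ≥ 2` AND EVERY TARGET
# PASS PROBABILITY `β` STRICTLY BETWEEN `0` AND THE DRIFT-FREE (STUDENT-TYPE) VALUE THERE IS
# EXACTLY ONE DRIFT `δ ≥ 0` WITH `(N^{⊗a} ⊗ N^{⊗a}){a(ḡ − h̄ + δ)² ≤ t²(s²(g) + s²(h))} = β`

HONEST FRAMING: exact (Metropolis-corrected) sampling algorithms for lattice gauge theory;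
figures of merit are autocorrelation/cost numbers at stated couplings and volumes; no
continuum-physics claim.

Venture `LatticeQCDFlow` (cell pub-lqcd), topic `Scoring`; FANOUT row 4 (`s0-u1-b`, GEN-34).
NEW WORK of the cell (classical), no definition, nothing cited as a fact (the non-central `t`
quantile NAMED ONLY).

WHY (row 4).  `Scoring/GaussianStudentShiftMonotone` shows that the limiting pass probability of
row 4's fixed-count A-vs-B criterion (`a` bins per arm) under a drift `δ` is the shifted-cone
probability `G(δ√a/√2)`, continuous, strictly decreasing on `[0, ∞)` for `t ≠ 0`, tending to `0`.
The threshold calculus of `Scoring/GaussianShiftedSectionProduct`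
(`existsUnique_Ici_of_strictAntiOn_tendsto_zero`) then makes "the smallest between-implementation
discrepancy the fixed-count criterion detects with probability `1 − β`" a well-defined number:
**`pi_gaussianReal_twoSample_student_shift_threshold_existsUnique`**.  Its numerical value (a
non-central `t` quantile) is NOT claimed.
-/

open MeasureTheory ProbabilityTheory Filter Topology Finset
open scoped ENNReal

namespace Summit.Ventures.LatticeQCDFlow.Scoring

open Set

section TwoSample

/-- **THE DETECTABLE DRIFT OF THE FIXED-COUNT A-VS-B CRITERION**: for `t ≠ 0`, `a ≥ 2` and every
target pass probability `β` strictly between `0` and the drift-free (Student-type) value, there is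
exactly one drift `δ ≥ 0` at which `(N^{⊗a} ⊗ N^{⊗a}){a(ḡ − h̄ + δ)² ≤ t²(s²(g) + s²(h))} = β`. [ours] -/
theorem pi_gaussianReal_twoSample_student_shift_threshold_existsUnique {t : ℝ} (ht : t ≠ 0) {n : ℕ}
    (hn : 1 ≤ n) {β : ℝ} (hβ0 : 0 < β)
    (hβ1 : β < ((Measure.pi fun _ : Fin (n + 1) => gaussianReal 0 1).prod
        (Measure.pi fun _ : Fin (n + 1) => gaussianReal 0 1)).real
      {p : (Fin (n + 1) → ℝ) × (Fin (n + 1) → ℝ) |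
        ((n + 1 : ℕ) : ℝ) * ((∑ i, p.1 i) / ((n + 1 : ℕ) : ℝ) - (∑ i, p.2 i) / ((n + 1 : ℕ) : ℝ) + 0) ^ 2
          ≤ t ^ 2 * (((∑ j, (p.1 j - (∑ i, p.1 i) / ((n + 1 : ℕ) : ℝ)) ^ 2) / (((n + 1 : ℕ) : ℝ) - 1))
            + ((∑ j, (p.2 j - (∑ i, p.2 i) / ((n + 1 : ℕ) : ℝ)) ^ 2) / (((n + 1 : ℕ) : ℝ) - 1)))}) :
    ∃! δ : ℝ, 0 ≤ δ ∧ ((Measure.pi fun _ : Fin (n + 1) => gaussianReal 0 1).prod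
        (Measure.pi fun _ : Fin (n + 1) => gaussianReal 0 1)).real
      {p : (Fin (n + 1) → ℝ) × (Fin (n + 1) → ℝ) |
        ((n + 1 : ℕ) : ℝ) * ((∑ i, p.1 i) / ((n + 1 : ℕ) : ℝ) - (∑ i, p.2 i) / ((n + 1 : ℕ) : ℝ) + δ) ^ 2
          ≤ t ^ 2 * (((∑ j, (p.1 j - (∑ i, p.1 i) / ((n + 1 : ℕ) : ℝ)) ^ 2) / (((n + 1 : ℕ) : ℝ) - 1))
            + ((∑ j, (p.2 j - (∑ i, p.2 i) / ((n + 1 : ℕ) : ℝ)) ^ 2) / (((n + 1 : ℕ) : ℝ) - 1)))} = β := by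
  -- transport to the cone picture: the pass probability is `G(δ · c₀)`, `c₀ = √a/√2`, with `G` the
  -- section function of `Scoring/GaussianShiftedSectionProduct` (no `set`: plain definitions)
  obtain ⟨c₀, hc₀⟩ : ∃ c : ℝ, c = Real.sqrt ((n + 1 : ℕ) : ℝ) / Real.sqrt 2 := ⟨_, rfl⟩
  have hc : 0 < c₀ := by rw [hc₀]; positivity
  obtain ⟨G, hG⟩ : ∃ G : ℝ → ℝ, ∀ κ, G κ = ((gaussianReal 0 1).prod
      (Measure.pi fun _ : Fin (n + n) => gaussianReal 0 1)).real
      {p : ℝ × (Fin (n + n) → ℝ) | (p.1 + κ) ^ 2 ≤ t ^ 2 * (∑ k, p.2 k ^ 2) / ((n + n : ℕ) : ℝ)} :=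
    ⟨_, fun _ => rfl⟩
  have hrepr : ∀ δ : ℝ, ((Measure.pi fun _ : Fin (n + 1) => gaussianReal 0 1).prod
        (Measure.pi fun _ : Fin (n + 1) => gaussianReal 0 1)).real
      {p : (Fin (n + 1) → ℝ) × (Fin (n + 1) → ℝ) |
        ((n + 1 : ℕ) : ℝ) * ((∑ i, p.1 i) / ((n + 1 : ℕ) : ℝ) - (∑ i, p.2 i) / ((n + 1 : ℕ) : ℝ) + δ) ^ 2
          ≤ t ^ 2 * (((∑ j, (p.1 j - (∑ i, p.1 i) / ((n + 1 : ℕ) : ℝ)) ^ 2) / (((n + 1 : ℕ) : ℝ) - 1))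
            + ((∑ j, (p.2 j - (∑ i, p.2 i) / ((n + 1 : ℕ) : ℝ)) ^ 2) / (((n + 1 : ℕ) : ℝ) - 1)))}
      = G (δ * c₀) := fun δ => by
    rw [hG, measureReal_def, measureReal_def, pi_gaussianReal_twoSample_student_shift_eq_prod t δ hn,
      hc₀, mul_div_assoc]
  have hGF : G = fun κ => ((gaussianReal 0 1).prod
      (Measure.pi fun _ : Fin (n + n) => gaussianReal 0 1)).real
      {p : ℝ × (Fin (n + n) → ℝ) | (p.1 + κ) ^ 2 ≤ t ^ 2 * (∑ k, p.2 k ^ 2) / ((n + n : ℕ) : ℝ)} :=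
    funext hG
  have hgm : Measurable fun w : Fin (n + n) → ℝ => t ^ 2 * (∑ j, w j ^ 2) / ((n + n : ℕ) : ℝ) :=
    measurable_coneThreshold t (n + n)
  have hGcont : Continuous G := by
    have h := continuous_prod_shiftedSection (ν := Measure.pi fun _ : Fin (n + n) => gaussianReal 0 1)
      (g := fun w : Fin (n + n) → ℝ => t ^ 2 * (∑ j, w j ^ 2) / ((n + n : ℕ) : ℝ)) hgm
    rw [hGF]; exact h
  have hGanti : StrictAntiOn G (Ici 0) := by
    have h := prod_shiftedSection_strictAntiOn (ν := Measure.pi fun _ : Fin (n + n) => gaussianReal 0 1)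
      (g := fun w : Fin (n + n) → ℝ => t ^ 2 * (∑ j, w j ^ 2) / ((n + n : ℕ) : ℝ)) hgm
      (pi_gaussianReal_coneThreshold_pos ht (show 1 ≤ n + n by omega))
    rw [hGF]; exact h
  have hGlim : Tendsto G atTop (𝓝 0) := by
    have h := tendsto_prod_shiftedSection_atTop (ν := Measure.pi fun _ : Fin (n + n) => gaussianReal 0 1)
      (g := fun w : Fin (n + n) → ℝ => t ^ 2 * (∑ j, w j ^ 2) / ((n + n : ℕ) : ℝ)) hgm
    rw [hGF]; exact h
  -- the composed function `δ ↦ G(δ c₀)` inherits the three properties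
  have hHcont : Continuous fun δ : ℝ => G (δ * c₀) := hGcont.comp (continuous_id.mul continuous_const)
  have hHanti : StrictAntiOn (fun δ : ℝ => G (δ * c₀)) (Ici 0) := by
    intro δ hδ δ' hδ' hlt
    exact hGanti (Set.mem_Ici.2 (mul_nonneg (Set.mem_Ici.1 hδ) hc.le))
      (Set.mem_Ici.2 (mul_nonneg (Set.mem_Ici.1 hδ') hc.le)) (mul_lt_mul_of_pos_right hlt hc)
  have hHlim : Tendsto (fun δ : ℝ => G (δ * c₀)) atTop (𝓝 0) :=
    hGlim.comp (Filter.Tendsto.atTop_mul_const hc tendsto_id)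
  have hβ1' : β < (fun δ : ℝ => G (δ * c₀)) 0 := by
    simp only
    rw [← hrepr 0]
    exact hβ1
  obtain ⟨δ, ⟨hδ0, hδβ⟩, huniq⟩ :=
    existsUnique_Ici_of_strictAntiOn_tendsto_zero hHcont hHanti hHlim hβ0 hβ1'
  refine ⟨δ, ⟨hδ0, by rw [hrepr δ]; exact hδβ⟩, ?_⟩
  rintro δ₂ ⟨hδ₂0, hδ₂β⟩
  exact huniq δ₂ ⟨hδ₂0, by rw [← hrepr δ₂]; exact hδ₂β⟩

end TwoSample

end Summit.Ventures.LatticeQCDFlow.Scoring
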